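import Mathlib.Analysis.SpecialFunctions.Pow.Real
import HarnessLib

/-!
# The single-point blocking lemma behind the cap budget for two contacts (pure real arithmetic), I

HONEST FRAMING. Part of the venture `Summits/Ventures/Crystal3D` (cell `crystal3d-full`), helper
`--supports` the crux `NoReconstructionGain` (stmt-Ventures-19144, route
`route-Ventures-StickyWulffConstant`), line `adhesion` (wulff-p1 g11); a brick of the open stub
`stub_frameCapBudget` (skeleton v12), case of two substrate contacts.

Everything is in CUBIC COORDINATES of the (moved) fcc bond star, scaled so that unit vectors have
coordinate square-sum `2`: the twelve star directions are `(±1,±1,0), (±1,0,±1), (0,±1,±1)`, the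
inner product of unit vectors with coordinates `(x,y,z)` and `(a,b,c)` is `(ax+by+cz)/2`, and `u`
BLOCKS the direction `(ε₁,ε₂,ε₃)` (angle `< 60°`) iff `ε₁x+ε₂y+ε₃z > 1`.  The pole `S = −ν` has sorted
coordinates `0 ≤ a ≤ b ≤ c` (a lattice symmetry arranges this), so the six DOWN directions and their
depths `2⟪d, S⟫` are `d₁=(0,1,1): b+c`, `d₂=(1,0,1): a+c`, `d₃=(1,1,0): a+b`, `d₄=(−1,0,1): c−a`,
`d₅=(0,−1,1): c−b`, `d₆=(−1,1,0): b−a`.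

* `spl2_coords` — if `u = (x,y,z)` is STRICTLY DEEPER THAN `d₂` (`ax+by+cz > a+c`) and `u ≠ d₁`, then
  `u` blocks two distinct down directions of strictly positive depth; the conclusion lists the eight
  possible witness pairs with the sign facts making them strictly down.  Proof: case analysis over the
  fourteen faces of the spherical cuboctahedron (`|z| ≥ |x|+|y|` etc. are the squares —
  `spl2_sqPosZ`, `spl2_sqPosY`, `spl2_sqPosX`, `spl2_sqNegX`, the squares about `−y`, `−z` being too
  shallow — and the octants of the remainder the triangles, `spl2_triPosZ`, those with `z < 0` being too
  shallow); in a square a non-vertex point blocks two adjacent vertices, in a triangle all three, and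
  the faces whose blocked vertices are not down enough are exactly the faces on which the depth cannot
  exceed `a+c`.

With the steep half (`t ≤ (a+c)/2`: `d₁, d₂` are steep) this is the cap budget for two contacts.

WHAT THIS IS NOT: the three-contact case; rung F-C1 not moved.
-/

namespace Summit.Ventures.Crystal3D.Theorems

/-- `p² + q² ≤ 2` gives `p + q ≤ 2`. -/
theorem add_le_two_of_sq_add_sq_le_two {p q : ℝ} (h : p ^ 2 + q ^ 2 ≤ 2) : p + q ≤ 2 := by
  nlinarith [sq_nonneg (p - q), sq_nonneg (p + q - 2), sq_nonneg (p + q + 2)]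

/-- The weighted version: `a ≤ c`, `z ≤ w`, `w² + z² ≤ 2`, `0 ≤ a + c` give `a w + c z ≤ a + c`. -/
theorem weighted_le_of_sq_add_sq_le_two {a c w z : ℝ} (hac : a ≤ c) (hzw : z ≤ w)
    (h : w ^ 2 + z ^ 2 ≤ 2) (ha : 0 ≤ a + c) : a * w + c * z ≤ a + c := by
  have h1 : w + z ≤ 2 := add_le_two_of_sq_add_sq_le_two h
  have h2 : a * w + c * z = (a + c) / 2 * (w + z) + (a - c) / 2 * (w - z) := by ring
  rw [h2]
  nlinarith [mul_nonneg (sub_nonneg.2 hac) (sub_nonneg.2 hzw)]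

/-- `x² ≤ 2`, `0 ≤ a ≤ c` give `a x ≤ a + c`. -/
theorem mul_le_add_of_sq_le_two {a c x : ℝ} (ha : 0 ≤ a) (hac : a ≤ c) (hx : x ^ 2 ≤ 2) :
    a * x ≤ a + c := by
  have hx' : x ≤ 3 / 2 := by nlinarith [sq_nonneg (x - 3 / 2), sq_nonneg (x + 3 / 2)]
  nlinarith

/-- `x² = 1` gives `x = 1 ∨ x = -1`. -/
theorem eq_one_or_eq_neg_one_of_sq {x : ℝ} (h : x ^ 2 = 1) : x = 1 ∨ x = -1 := by
  have h0 : (x - 1) * (x + 1) = 0 := by ring_nf; linarith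
  rcases mul_eq_zero.1 h0 with h1 | h1
  · exact Or.inl (by linarith)
  · exact Or.inr (by linarith)

/-- A dominant coordinate is at least `1`: `|p| + |q| ≤ w`, `p² + q² + w² = 2` give `1 ≤ w`. -/
theorem one_le_of_dominant {p q w : ℝ} (h : |p| + |q| ≤ w) (hs : p ^ 2 + q ^ 2 + w ^ 2 = 2) : 1 ≤ w := by
  have hw0 : 0 ≤ w := le_trans (by positivity) h
  have h1 : (|p| + |q|) ^ 2 ≤ w ^ 2 := by
    have : 0 ≤ |p| + |q| := by positivity
    nlinarith
  have h2 : p ^ 2 + q ^ 2 ≤ (|p| + |q|) ^ 2 := by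
    nlinarith [sq_abs p, sq_abs q, abs_nonneg p, abs_nonneg q]
  have hww : 1 ≤ w ^ 2 := by nlinarith
  by_contra hlt; push Not at hlt
  nlinarith [mul_pos (show (0:ℝ) < 1 - w by linarith) (show (0:ℝ) < 1 + w by linarith)]

/-- In a triangle: `0 ≤ w < p + q` with `p, q ≥ 0` and `w² + p² + q² = 2` gives `p + q > 1`. -/
theorem one_lt_add_of_triangle {p q w : ℝ} (hw : 0 ≤ w) (hp : 0 ≤ p) (hq : 0 ≤ q) (h : w < p + q)
    (hs : w ^ 2 + p ^ 2 + q ^ 2 = 2) : 1 < p + q := by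
  have h1 : w ^ 2 < (p + q) ^ 2 := by
    nlinarith [mul_pos (show (0:ℝ) < p + q - w by linarith) (show (0:ℝ) < p + q + w by linarith)]
  have h2 : 1 < (p + q) ^ 2 := by nlinarith [mul_nonneg hp hq]
  by_contra hle; push Not at hle
  have hpq : 0 ≤ p + q := by linarith
  nlinarith [mul_nonneg hpq hpq]

section spl
variable {a b c x y z : ℝ} (ha : 0 ≤ a) (hab : a ≤ b) (hbc : b ≤ c)
  (hS : a ^ 2 + b ^ 2 + c ^ 2 = 2) (hu : x ^ 2 + y ^ 2 + z ^ 2 = 2)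
  (hdc : a + c < a * x + b * y + c * z)
include ha hab hbc hS hu hdc

omit hu in
/-- If all of `a, b, c` are equal then `x + y + z > 2`. -/
theorem spl2_all_eq (hac : a = c) : 2 < x + y + z := by
  have hab' : a = b := le_antisymm hab (hac ▸ hbc)
  have hc : 0 < c := by nlinarith
  rw [← hab', hac] at hdc
  nlinarith

set_option maxHeartbeats 400000 in
/-- Face `z ≥ |x| + |y|` (the square about `+z`). -/
theorem spl2_sqPosZ (hne : ¬ (x = 0 ∧ y = 1 ∧ z = 1)) (hF : |x| + |y| ≤ z) :
    (1 < y + z ∧ 1 < x + z) ∨ (1 < y + z ∧ 1 < z - x ∧ a < c) ∨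
    (1 < x + z ∧ 1 < z - y ∧ b < c) ∨ (1 < z - x ∧ 1 < z - y ∧ a < c ∧ b < c) := by
  have hc : 0 < c := by nlinarith
  have hz1 : 1 ≤ z := one_le_of_dominant hF (by linarith)
  have hz2 : z ≤ 3 / 2 := by nlinarith [sq_nonneg (z - 3/2), sq_nonneg x, sq_nonneg y]
  rcases le_or_gt 0 x with hx | hx <;> rcases le_or_gt 0 y with hy | hy
  · -- (+,+): d₁, d₂
    left
    refine ⟨?_, ?_⟩
    · by_contra h; push Not at h
      have hy0 : y = 0 := by linarith
      have hz : z = 1 := by linarith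
      have hx2 : x ^ 2 = 1 := by rw [hy0, hz] at hu; linarith
      rcases eq_one_or_eq_neg_one_of_sq hx2 with hx1 | hx1
      · rw [hy0, hz, hx1] at hdc; linarith
      · linarith
    · by_contra h; push Not at h
      have hx0 : x = 0 := by linarith
      have hz : z = 1 := by linarith
      have hy2 : y ^ 2 = 1 := by rw [hx0, hz] at hu; linarith
      rcases eq_one_or_eq_neg_one_of_sq hy2 with hy1 | hy1
      · exact hne ⟨hx0, hy1, hz⟩
      · linarith
  · -- x ≥ 0 > y: d₂ and (d₅ or d₁)
    have hxz : 1 < x + z := by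
      by_contra h; push Not at h
      have hx0 : x = 0 := by linarith
      have hz : z = 1 := by linarith
      have hy2 : y ^ 2 = 1 := by rw [hx0, hz] at hu; linarith
      rcases eq_one_or_eq_neg_one_of_sq hy2 with hy1 | hy1
      · linarith
      · rw [hx0, hy1, hz] at hdc; linarith
    rcases lt_or_eq_of_le hbc with hbc' | hbc'
    · right; right; left
      exact ⟨hxz, by linarith, hbc'⟩
    · left
      refine ⟨?_, hxz⟩
      by_contra h; push Not at h
      rw [hbc'] at hdc
      have h1 : a < a * x := by nlinarith
      rcases eq_or_lt_of_le ha with ha0 | ha0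
      · rw [← ha0] at h1; linarith
      · have hx1 : 1 < x := by
          by_contra h'; push Not at h'
          nlinarith [mul_nonneg ha0.le (sub_nonneg.2 h')]
        nlinarith
  · -- x < 0 ≤ y: d₁ and d₄
    right; left
    refine ⟨?_, by linarith, ?_⟩
    · by_contra h; push Not at h
      have hy0 : y = 0 := by linarith
      have hz : z = 1 := by linarith
      have hx2 : x ^ 2 = 1 := by rw [hy0, hz] at hu; linarith
      rcases eq_one_or_eq_neg_one_of_sq hx2 with hx1 | hx1
      · linarith
      · rw [hx1, hy0, hz] at hdc; linarith
    · by_contra h; push Not at h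
      have hac : a = c := le_antisymm (le_trans hab hbc) h
      have h2 := spl2_all_eq ha hab hbc hS hdc hac
      have hyz : y + z ≤ 2 := add_le_two_of_sq_add_sq_le_two (by nlinarith)
      linarith
  · -- x < 0, y < 0: d₄ and (d₅ or d₁)
    have hzx : 1 < z - x := by linarith
    have hac : a < c := by
      by_contra h; push Not at h
      have h2 := spl2_all_eq ha hab hbc hS hdc (le_antisymm (le_trans hab hbc) h)
      linarith
    rcases lt_or_eq_of_le hbc with hbc' | hbc'
    · right; right; right
      exact ⟨hzx, by linarith, hac, hbc'⟩
    · right; left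
      refine ⟨?_, hzx, hac⟩
      rw [hbc'] at hdc
      have h1 : a * x ≤ 0 := by nlinarith
      nlinarith

set_option maxHeartbeats 400000 in
/-- Face `y ≥ |x| + |z|` (the square about `+y`). -/
theorem spl2_sqPosY (hne : ¬ (x = 0 ∧ y = 1 ∧ z = 1)) (hF : |x| + |z| ≤ y) :
    (1 < y + z ∧ 1 < x + y ∧ 0 < a + b) ∨ (1 < y + z ∧ 1 < y - x ∧ a < b) := by
  have hc : 0 < c := by nlinarith
  have hy1 : 1 ≤ y := one_le_of_dominant hF (by linarith)
  -- `u` blocks d₁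
  have hyz : 1 < y + z := by
    rcases le_or_gt 0 z with hz | hz
    · by_contra h; push Not at h
      have hz0 : z = 0 := by linarith
      have hy : y = 1 := by linarith
      have hx2 : x ^ 2 = 1 := by rw [hz0, hy] at hu; linarith
      rcases eq_one_or_eq_neg_one_of_sq hx2 with hx1 | hx1
      · rw [hx1, hy, hz0] at hdc; nlinarith
      · rw [hx1, hy, hz0] at hdc; nlinarith
    · by_contra h; push Not at h
      rw [abs_of_neg hz] at hF
      have hxa : |x| ≤ 1 := by linarith
      have h1 : a * x ≤ a := by nlinarith [le_abs_self x]
      have h2 : b * y + c * z ≤ b := by nlinarith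
      linarith
  rcases le_or_gt 0 x with hx | hx
  · left
    refine ⟨hyz, ?_, ?_⟩
    · by_contra h; push Not at h
      have hx0 : x = 0 := by linarith
      have hy : y = 1 := by linarith
      have hz2 : z ^ 2 = 1 := by rw [hx0, hy] at hu; linarith
      rcases eq_one_or_eq_neg_one_of_sq hz2 with hz1 | hz1
      · exact hne ⟨hx0, hy, hz1⟩
      · rw [hx0, hy, hz1] at hdc; nlinarith
    · by_contra h; push Not at h
      have ha0 : a = 0 := by linarith
      have hb0 : b = 0 := by linarith
      rw [ha0, hb0] at hdc
      have hz1 : 1 < z := by nlinarith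
      have : |z| ≤ y := le_trans (by linarith [abs_nonneg x]) hF
      rw [abs_of_pos (by linarith)] at this
      nlinarith
  · right
    refine ⟨hyz, by linarith, ?_⟩
    by_contra h; push Not at h
    have hab' : a = b := le_antisymm hab h
    rw [← hab'] at hdc
    rw [abs_of_neg hx] at hF
    rcases le_or_gt 0 z with hz | hz
    · rw [abs_of_nonneg hz] at hF
      have hs : z ≤ x + y := by linarith
      have hs2 : (x + y) ^ 2 + z ^ 2 ≤ 2 := by nlinarith [mul_nonneg (neg_nonneg.2 hx.le) (show (0:ℝ) ≤ y by linarith)]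
      have := weighted_le_of_sq_add_sq_le_two (le_trans hab hbc) hs hs2 (by linarith)
      nlinarith
    · have hs2 : (x + y) ^ 2 ≤ 2 := by
        rw [abs_of_neg hz] at hF
        nlinarith [mul_nonneg (neg_nonneg.2 hx.le) (show 0 ≤ y by linarith)]
      have h1 := mul_le_add_of_sq_le_two ha (le_trans hab hbc) hs2
      nlinarith

end spl

end Summit.Ventures.Crystal3D.Theorems
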